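import Mathlib
import Summits.NavierStokesRegularity.FluidComputer.TorusHighBandCeilingFlow
import Literature.Analysis.FluidPDE.CheskidovAssemblyTools
import Literature.Analysis.FluidPDE.TorusClassicalLerayHopfProofs
import HarnessLib

/-!
# The high-band ceiling for CLASSICAL solutions of the periodic Navier–Stokes equations

HONEST FRAMING (cell `ns-blowup`, seat `ns-blowup-circuit` g6, human ruling D-0035): nothing here is a
claim about Navier–Stokes blow-up. WHAT THIS IS NOT: not a regularity criterion, not blow-up evidence.
Part 4 of `TorusHighBandFluxCeiling` / `TorusHighBandCeiling` / `TorusHighBandCeilingFlow`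
(p445097 / p445831 / p446381): the hypotheses of `highBand_ceiling` are DISCHARGED for the tree's
classical solutions `Torus.IsClassicalNSSolutionOn (Icc 0 T) ν f u p` (`T > 0`, `ν > 0`): they are
Leray–Hopf (`Torus.IsClassicalNSSolutionOn.isLerayHopfOn_of_convex`), their force is jointly smooth
(the momentum equation determines it), hence jointly measurable and in `L¹(0,T;L²)`, and the
high-band energy `s ↦ ½‖Q_M u(s)‖²` is continuous on `[0,T]` (uniform convergence of jointly smooth
slices). Result: `highBand_ceiling_classical` — for every band edge `M` and every level `G` with
`K_M(u(s))‖u(s)‖₂ + ‖f(s)‖₂ ≤ G` for a.e. `s ∈ (0,T)`,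
`‖Q_M u(t)‖₂ ≤ max(‖Q_M u(0)‖₂, G/(4π²ν(M²+1)))` on `[0,T]`; and the contrapositive
`lowStrain_large_of_highBand_growth_classical`. No definitions.
-/

noncomputable section

open MeasureTheory Set Filter UnitAddTorus Function
open scoped ENNReal NNReal InnerProductSpace RealInnerProductSpace Topology

namespace Summit.NavierStokesRegularity.FluidComputer.TorusHighBandFluxCeiling

open Literature.Analysis Literature.Analysis.FunctionSpaces Literature.Analysis.FluidPDE

variable {d : Type*} [Fintype d] [DecidableEq d]

section Classical

variable {S : Set ℝ} {T ν : ℝ} {f u : ℝ → UnitAddTorus d → EuclideanSpace ℝ d} {p : ℝ → UnitAddTorus d → ℝ}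

/-- The force of a classical solution is jointly smooth on the time set (of unique
differentiability): `f = ∂ₜu + (u·∇)u − νΔu + ∇p` by the momentum equation (copy of the file-private
helper of `TorusClassicalLerayHopfProofs`). [folklore] -/
theorem isSmoothSpaceTimeOn_force_of_classical (h : Torus.IsClassicalNSSolutionOn S ν f u p)
    (hU : UniqueDiffOn ℝ S) : Torus.IsSmoothSpaceTimeOn S f := by
  have hu := h.smooth_velocity
  have hG : Torus.IsSmoothSpaceTimeOn S (fun t x => Torus.timeDerivWithin S u t x +
      Torus.convect (u t) (u t) x - ν • Torus.laplacian (u t) x + Torus.gradient (p t) x) :=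
    (((hu.timeDerivWithin hU).add (hu.convect hu hU)).sub ((hu.laplacian hU).const_smul ν)).add
      (h.smooth_pressure.gradient hU)
  refine ContDiffOn.congr hG fun z hz => ?_
  obtain ⟨t, y⟩ := z
  have ht : t ∈ S := (mem_prod.1 hz).1
  simp only [Torus.stLift_apply]
  rw [h.momentum t ht (Torus.proj y)]
  abel

omit [DecidableEq d] in
/-- A jointly smooth field on `[0,T] × T^d` is jointly measurable on `(0,T) × T^d` and lies in
`L¹(0,T; L²)` (bounded on the compact `[0,T] × T^d`). [folklore] -/
theorem force_bookkeeping_of_smooth (hf : Torus.IsSmoothSpaceTimeOn (Icc 0 T) f) :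
    AEStronglyMeasurable (Torus.stLift f) (volume.restrict (Ioo 0 T ×ˢ univ)) ∧
      FluidPDE.Torus.MemLqLp 1 2 f (Ioo 0 T) := by
  have hcont : ContinuousOn (Torus.stLift f) (Ioo 0 T ×ˢ univ) :=
    hf.continuousOn_stLift.mono (prod_mono Ioo_subset_Icc_self le_rfl)
  refine ⟨hcont.aestronglyMeasurable (measurableSet_Ioo.prod MeasurableSet.univ), ?_, ?_⟩
  · filter_upwards [ae_restrict_mem measurableSet_Ioo] with t ht
    exact (hf.isSmooth_slice (Ioo_subset_Icc_self ht)).memLp 2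
  · obtain ⟨C', hC'⟩ := hf.exists_norm_le_of_isCompact isCompact_Icc subset_rfl
    set C : ℝ := max C' 0 with hCdef
    have hC0 : 0 ≤ C := le_max_right _ _
    have hC : ∀ t ∈ Icc 0 T, ∀ x, ‖f t x‖ ≤ C := fun t ht x => (hC' t ht x).trans (le_max_left _ _)
    -- slice bound `‖f t‖_{L²} ≤ C` on `(0,T)`
    have hslice : ∀ t ∈ Ioo 0 T, (eLpNorm (f t) 2 volume).toReal ≤ C := by
      intro t ht
      have h1 : eLpNorm (f t) 2 volume ≤ ENNReal.ofReal C := by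
        have h := eLpNorm_le_of_ae_bound (μ := (volume : Measure (UnitAddTorus d))) (p := 2)
          (f := f t) (ae_of_all _ fun x => hC t (Ioo_subset_Icc_self ht) x)
        simpa [measure_univ] using h
      exact (ENNReal.toReal_mono ENNReal.ofReal_ne_top h1).trans (by rw [ENNReal.toReal_ofReal hC0])
    rw [FluidPDE.eLqLpNorm_def]
    have hb : ∀ᵐ t ∂(volume.restrict (Ioo 0 T)), ‖(eLpNorm (f t) 2 volume).toReal‖ ≤ C := by
      filter_upwards [ae_restrict_mem measurableSet_Ioo] with t ht
      rw [Real.norm_eq_abs, abs_of_nonneg ENNReal.toReal_nonneg]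
      exact hslice t ht
    refine (eLpNorm_le_of_ae_bound hb).trans_lt ?_
    refine ENNReal.mul_lt_top ?_ ENNReal.ofReal_lt_top
    refine ENNReal.rpow_lt_top_of_nonneg (by simp) ?_
    rw [Measure.restrict_apply_univ, Real.volume_Ioo]
    exact ENNReal.ofReal_ne_top

omit [DecidableEq d] in
/-- **Fourier coefficients of a jointly smooth field are continuous in time** (uniform convergence
of the slices, `Torus.IsSmoothSpaceTimeOn.eventually_norm_sub_lt`, and `‖ĝ(k)‖ ≤ sup‖g‖`). [folklore] -/
theorem continuousOn_mFourierCoeff_of_smooth (hu : Torus.IsSmoothSpaceTimeOn S u) (k : d → ℤ) :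
    ContinuousOn (fun s => mFourierCoeff (EuclideanSpace.complexify ∘ u s) k) S := by
  intro t ht
  refine Metric.continuousWithinAt_iff'.2 fun ε hε => ?_
  filter_upwards [hu.eventually_norm_sub_lt ht (half_pos hε), self_mem_nhdsWithin] with s hs hsS
  have his : Integrable (EuclideanSpace.complexify ∘ u s) volume :=
    Torus.integrable_complexify_comp (hu.isSmooth_slice hsS).integrable
  have hit : Integrable (EuclideanSpace.complexify ∘ u t) volume :=
    Torus.integrable_complexify_comp (hu.isSmooth_slice ht).integrable
  rw [dist_eq_norm, ← Torus.mFourierCoeff_sub his hit, ← Torus.complexify_comp_sub]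
  refine (Torus.norm_mFourierCoeff_le_of_forall_norm_le (C := ε / 2) (fun x => ?_) k).trans_lt
    (half_lt_self hε)
  rw [Function.comp_apply, Pi.sub_apply, EuclideanSpace.norm_complexify]
  exact (hs x).le

/-- **The high-band energy of a jointly smooth field is continuous in time** on a convex time set:
`½‖Q_M u(s)‖² = ½(∫‖u(s)‖² − ∑_{|k|≤M}‖û(s,k)‖²)` (Pythagoras + Parseval on the ball), a continuous
energy minus finitely many continuous coefficients. [folklore] -/
theorem continuousOn_highBand_energy (hu : Torus.IsSmoothSpaceTimeOn S u) (hS : Convex ℝ S) (M : ℕ) :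
    ContinuousOn (fun s => Torus.kineticEnergy (u s - Torus.fourierTruncate M (u s))) S := by
  classical
  have hE : ContinuousOn (fun s => ∫ x, ‖u s x‖ ^ 2) S := hu.continuousOn_integral_norm_sq hS
  have hsum : ContinuousOn (fun s => ∑ k ∈ Torus.freqBall M,
      ‖mFourierCoeff (EuclideanSpace.complexify ∘ u s) k‖ ^ 2) S :=
    continuousOn_finsetSum _ fun k _ => ((continuousOn_mFourierCoeff_of_smooth hu k).norm).pow 2
  have hrepr : EqOn (fun s => Torus.kineticEnergy (u s - Torus.fourierTruncate M (u s)))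
      (fun s => 2⁻¹ * ((∫ x, ‖u s x‖ ^ 2) - ∑ k ∈ Torus.freqBall M,
        ‖mFourierCoeff (EuclideanSpace.complexify ∘ u s) k‖ ^ 2)) S := by
    intro s hs
    have hus : MemLp (u s) 2 volume := (hu.isSmooth_slice hs).memLp 2
    simp only [Torus.kineticEnergy]
    rw [integral_norm_sq_eq_add_highBand hus M,
      Torus.integral_norm_sq_fourierTruncate (hus.integrable one_le_two) M]
    simp only [Pi.sub_apply]; ring
  exact (continuousOn_const.mul (hE.sub hsum)).congr hrepr

/-- **THE HIGH-BAND CEILING for classical solutions of the periodic Navier–Stokes equations.** Let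
`(u, p)` be a classical solution of `∂ₜu + (u·∇)u = νΔu − ∇p + f`, `div u = 0` on `[0,T] × T^d`
(`Torus.IsClassicalNSSolutionOn (Icc 0 T) ν f u p`), `T > 0`, `ν > 0`; `M` a band edge and `G` a
level with `K_M(u(s))·‖u(s)‖₂ + ‖f(s)‖₂ ≤ G` for a.e. `s ∈ (0,T)` (`K_M = Torus.truncDerivBound M`,
`‖·‖₂ = (∫‖·‖²)^{1/2}`). Then for every `t ∈ [0,T]`,
`‖u(t) − P_M u(t)‖₂ ≤ max(‖u(0) − P_M u(0)‖₂, G / (4π²ν(M²+1)))`. [folklore] -/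
theorem highBand_ceiling_classical (h : Torus.IsClassicalNSSolutionOn (Icc 0 T) ν f u p) (hT : 0 < T)
    (hν : 0 < ν) (M : ℕ) {G : ℝ}
    (hG : ∀ᵐ s ∂(volume.restrict (Ioo 0 T)),
      FluidPDE.Torus.truncDerivBound M (u s) * Real.sqrt (∫ x, ‖u s x‖ ^ 2) +
        Real.sqrt (∫ x, ‖f s x‖ ^ 2) ≤ G) :
    ∀ t ∈ Icc 0 T, Real.sqrt (2 * Torus.kineticEnergy (u t - Torus.fourierTruncate M (u t))) ≤
      max (Real.sqrt (2 * Torus.kineticEnergy (u 0 - Torus.fourierTruncate M (u 0))))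
        (G / (4 * Real.pi ^ 2 * ν * ((M : ℝ) ^ 2 + 1))) := by
  have hLH := h.isLerayHopfOn_of_convex (convex_Icc 0 T) hT subset_rfl
  obtain ⟨hfm, hf⟩ := force_bookkeeping_of_smooth
    (isSmoothSpaceTimeOn_force_of_classical h (uniqueDiffOn_Icc hT))
  exact highBand_ceiling hLH hT hfm hf hν M hG
    (continuousOn_highBand_energy h.smooth_velocity (convex_Icc 0 T) M)

/-- **Contrapositive for classical solutions — the coherence law for Navier–Stokes itself.** In the
setting of `highBand_ceiling_classical`: if at some `t ∈ [0,T]` the high band exceeds both its initial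
size and a level `X`, `‖Q_M u(t)‖₂ > max(‖Q_M u(0)‖₂, X)`, then on a set of times `s ∈ (0,T)` of
positive measure the low-band ℓ¹-strain plus forcing exceeded `4π²ν(M²+1)·X`:
`∃ᵐ s, 4π²ν(M²+1)·X < K_M(u(s))‖u(s)‖₂ + ‖f(s)‖₂`. [folklore] -/
theorem lowStrain_large_of_highBand_growth_classical
    (h : Torus.IsClassicalNSSolutionOn (Icc 0 T) ν f u p) (hT : 0 < T) (hν : 0 < ν) (M : ℕ)
    {X t : ℝ} (ht : t ∈ Icc 0 T)
    (hgrow : max (Real.sqrt (2 * Torus.kineticEnergy (u 0 - Torus.fourierTruncate M (u 0)))) X <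
      Real.sqrt (2 * Torus.kineticEnergy (u t - Torus.fourierTruncate M (u t)))) :
    ∃ᵐ s ∂(volume.restrict (Ioo 0 T)),
      4 * Real.pi ^ 2 * ν * ((M : ℝ) ^ 2 + 1) * X <
        FluidPDE.Torus.truncDerivBound M (u s) * Real.sqrt (∫ x, ‖u s x‖ ^ 2) +
          Real.sqrt (∫ x, ‖f s x‖ ^ 2) := by
  have hLH := h.isLerayHopfOn_of_convex (convex_Icc 0 T) hT subset_rfl
  obtain ⟨hfm, hf⟩ := force_bookkeeping_of_smooth
    (isSmoothSpaceTimeOn_force_of_classical h (uniqueDiffOn_Icc hT))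
  exact lowStrain_large_of_highBand_growth hLH hT hfm hf hν M
    (continuousOn_highBand_energy h.smooth_velocity (convex_Icc 0 T) M) ht hgrow

end Classical

end Summit.NavierStokesRegularity.FluidComputer.TorusHighBandFluxCeiling
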